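import Mathlib
import Summits.MatrixMultiplication.MatrixMultiplication.Theorems.GradedDesignFamily.Negative.SubfieldCellFreeOrbits

/-!
# Cusp forms on `SL₂(k)`: the range of `T_e` on `ℂ^{K²}` has dimension `≤ (q − 1)·rank R_e`
# (crux `LevelGradedCohnUmans.GradedDesignFamily`, stmt-MatrixMultiplication-7610; negative side,
# line `quadratic-extension-level-one-cell`, stub S3 `stub_subfieldCell`)

HONEST FRAMING.  Support for DECIDING the finite cells `q = 4, 5` of S3 by theorem (the
cusp-form wall); not summit progress.

Fix S3's data `φ : SL₂(k) →* GL₂(K)` (injective, `|K| = |k|²`) and a function `e : SL₂(k) → ℂ`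
that is CUSPIDAL for every conjugate of the root group: `Σ_x e(g · b u_x b⁻¹) = 0` for all
`g, b`.  Then

* `cuspForm_sum_eq_zero`: `Σ e = 0`;
* `cuspForm_finrank_range_le`: the operator `T₂ d = (w ↦ Σ_t e(t) d(φ(t) w))` on `ℂ^{K²}`
  has `dim range T₂ ≤ (|k| − 1) · dim range R_e`, `R_e u = (h ↦ Σ_t e(t) u(t h))` on
  `ℂ^{SL₂(k)}`.  Proof: `range T₂` is spanned by the `T₂ δ_w`; `T₂ δ_0 = 0` (`Σ e = 0`);
  `T₂ δ_w = 0` when `Stab_φ(w)` is a conjugate of the root group (cuspidality on the coset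
  `b U b⁻¹ t₀`); and for `w = φ(s₀) v` in the orbit of a representative `v`,
  `T₂ δ_w = ι_v (R_e δ_{s₀})` with `ι_v u = (w' ↦ Σ_{s : φ(s)v = w'} u(s))`; by
  `subfieldCell_orbitReps` at most `|k| − 1` representatives are needed.

Sorry-free; axioms `propext`, `Classical.choice`, `Quot.sound`.
-/

set_option linter.dupNamespace false

open scoped BigOperators
open Matrix Module

namespace Summit.MatrixMultiplication.MatrixMultiplication.Theorems.GradedDesignFamily.Negative

variable {k K : Type} [Field k] [Fintype k] [DecidableEq k] [Field K] [Fintype K] [DecidableEq K]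

omit [Fintype K] [DecidableEq K] in
/-- A function on `SL₂(k)` cuspidal for (all conjugates of) the root group has total sum `0`:
`q · Σ e = Σ_g Σ_x e(g u_x) = 0`. [folklore] -/
theorem cuspForm_sum_eq_zero (e : Matrix.SpecialLinearGroup (Fin 2) k → ℂ)
    (hcusp : ∀ g b : Matrix.SpecialLinearGroup (Fin 2) k,
      ∑ x : k, e (g * b * ⟨!![(1 : k), x; 0, 1], sl2md_det_upper x⟩ * b⁻¹) = 0) :
    ∑ t : Matrix.SpecialLinearGroup (Fin 2) k, e t = 0 := by
  have h1 : ∀ x : k, ∑ g : Matrix.SpecialLinearGroup (Fin 2) k,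
      e (g * 1 * ⟨!![(1 : k), x; 0, 1], sl2md_det_upper x⟩ * 1⁻¹) =
        ∑ g : Matrix.SpecialLinearGroup (Fin 2) k, e g := by
    intro x
    simp only [mul_one, inv_one]
    exact Fintype.sum_equiv (Equiv.mulRight ⟨!![(1 : k), x; 0, 1], sl2md_det_upper x⟩) _ _
      fun g => rfl
  have h2 : (Fintype.card k : ℂ) * ∑ t : Matrix.SpecialLinearGroup (Fin 2) k, e t = 0 := by
    calc (Fintype.card k : ℂ) * ∑ t : Matrix.SpecialLinearGroup (Fin 2) k, e t
        = ∑ x : k, ∑ g : Matrix.SpecialLinearGroup (Fin 2) k, e g := by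
          rw [Finset.sum_const, Finset.card_univ, nsmul_eq_mul]
      _ = ∑ x : k, ∑ g : Matrix.SpecialLinearGroup (Fin 2) k,
            e (g * 1 * ⟨!![(1 : k), x; 0, 1], sl2md_det_upper x⟩ * 1⁻¹) :=
          Finset.sum_congr rfl fun x _ => (h1 x).symm
      _ = ∑ g : Matrix.SpecialLinearGroup (Fin 2) k, ∑ x : k,
            e (g * 1 * ⟨!![(1 : k), x; 0, 1], sl2md_det_upper x⟩ * 1⁻¹) := Finset.sum_comm
      _ = 0 := Finset.sum_eq_zero fun g _ => hcusp g 1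
  exact (mul_eq_zero.1 h2).resolve_left (Nat.cast_ne_zero.2 Fintype.card_ne_zero)

/-- **Range bound for the cusp operator on `ℂ^{K²}`.**  For `φ : SL₂(k) →* GL₂(K)` injective
with `|K| = |k|²` and `e` cuspidal for all conjugate root groups,
`dim range T₂ ≤ (|k| − 1) · dim range R_e` (see the module docstring). [folklore] -/
theorem cuspForm_finrank_range_le
    (φ : Matrix.SpecialLinearGroup (Fin 2) k →* Matrix.GeneralLinearGroup (Fin 2) K)
    (hφ : Function.Injective φ) (hK : Fintype.card K = Fintype.card k ^ 2)
    (e : Matrix.SpecialLinearGroup (Fin 2) k → ℂ)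
    (hcusp : ∀ g b : Matrix.SpecialLinearGroup (Fin 2) k,
      ∑ x : k, e (g * b * ⟨!![(1 : k), x; 0, 1], sl2md_det_upper x⟩ * b⁻¹) = 0) :
    finrank ℂ (LinearMap.range (∑ t : Matrix.SpecialLinearGroup (Fin 2) k,
        e t • LinearMap.funLeft ℂ ℂ fun w : Fin 2 → K =>
          ((φ t : Matrix.GeneralLinearGroup (Fin 2) K) : Matrix (Fin 2) (Fin 2) K) *ᵥ w)) ≤
      (Fintype.card k - 1) * finrank ℂ (LinearMap.range
        (∑ t : Matrix.SpecialLinearGroup (Fin 2) k,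
          e t • LinearMap.funLeft ℂ ℂ fun h : Matrix.SpecialLinearGroup (Fin 2) k => t * h)) := by
  classical
  -- the operators
  set R : (Matrix.SpecialLinearGroup (Fin 2) k → ℂ) →ₗ[ℂ] (Matrix.SpecialLinearGroup (Fin 2) k → ℂ) :=
    ∑ t : Matrix.SpecialLinearGroup (Fin 2) k,
      e t • LinearMap.funLeft ℂ ℂ fun h : Matrix.SpecialLinearGroup (Fin 2) k => t * h with hR_def
  have hR : ∀ (u : Matrix.SpecialLinearGroup (Fin 2) k → ℂ) (h : Matrix.SpecialLinearGroup (Fin 2) k),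
      R u h = ∑ t, e t * u (t * h) := by
    intro u h
    simp only [hR_def, LinearMap.coe_sum, Finset.sum_apply, LinearMap.smul_apply,
      LinearMap.funLeft_apply, Pi.smul_apply, smul_eq_mul]
  set T₂ : ((Fin 2 → K) → ℂ) →ₗ[ℂ] ((Fin 2 → K) → ℂ) :=
    ∑ t : Matrix.SpecialLinearGroup (Fin 2) k,
      e t • LinearMap.funLeft ℂ ℂ fun w : Fin 2 → K =>
        ((φ t : Matrix.GeneralLinearGroup (Fin 2) K) : Matrix (Fin 2) (Fin 2) K) *ᵥ w with hT₂_def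
  have hT₂ : ∀ (d : (Fin 2 → K) → ℂ) (w : Fin 2 → K),
      T₂ d w = ∑ t, e t * d ((φ t).val *ᵥ w) := by
    intro d w
    simp only [hT₂_def, LinearMap.coe_sum, Finset.sum_apply, LinearMap.smul_apply,
      LinearMap.funLeft_apply, Pi.smul_apply, smul_eq_mul]
  have hsum := cuspForm_sum_eq_zero e hcusp
  -- the action through `φ`
  have hact : ∀ (s t : Matrix.SpecialLinearGroup (Fin 2) k) (w : Fin 2 → K),
      (φ (s * t)).val *ᵥ w = (φ s).val *ᵥ ((φ t).val *ᵥ w) := by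
    intro s t w
    rw [map_mul, Units.val_mul, Matrix.mulVec_mulVec]
  have hact1 : ∀ w : Fin 2 → K, (φ 1).val *ᵥ w = w := by
    intro w
    rw [map_one, Units.val_one, Matrix.one_mulVec]
  have hcancel : ∀ (s : Matrix.SpecialLinearGroup (Fin 2) k) (w : Fin 2 → K),
      (φ s⁻¹).val *ᵥ ((φ s).val *ᵥ w) = w := by
    intro s w
    rw [← hact, inv_mul_cancel, hact1]
  -- orbit representatives
  obtain ⟨Reps, hReps, hdich⟩ := subfieldCell_orbitReps φ hφ hK
  -- `Ψ c = Σ_{v ∈ Reps} ι_v (c v)`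
  let Ψ : (↥Reps → ↥(LinearMap.range R)) →ₗ[ℂ] ((Fin 2 → K) → ℂ) :=
    { toFun := fun c w => ∑ v : ↥Reps, ∑ s : Matrix.SpecialLinearGroup (Fin 2) k,
        (if (φ s).val *ᵥ (v : Fin 2 → K) = w then (1 : ℂ) else 0) *
          ((c v : Matrix.SpecialLinearGroup (Fin 2) k → ℂ) s)
      map_add' := fun c c' => by
        funext w
        simp only [Pi.add_apply, Submodule.coe_add, mul_add, Finset.sum_add_distrib]
      map_smul' := fun a c => by
        funext w
        simp only [Pi.smul_apply, Submodule.coe_smul, smul_eq_mul, RingHom.id_apply,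
          Finset.mul_sum]
        refine Finset.sum_congr rfl fun v _ => Finset.sum_congr rfl fun s _ => ?_
        ring }
  have hΨ : ∀ (c : ↥Reps → ↥(LinearMap.range R)) (w : Fin 2 → K),
      Ψ c w = ∑ v : ↥Reps, ∑ s : Matrix.SpecialLinearGroup (Fin 2) k,
        (if (φ s).val *ᵥ (v : Fin 2 → K) = w then (1 : ℂ) else 0) *
          ((c v : Matrix.SpecialLinearGroup (Fin 2) k → ℂ) s) := fun c w => rfl
  -- `T₂ δ_w` case by case
  have hδ : ∀ w : Fin 2 → K, T₂ (Pi.single w 1) ∈ LinearMap.range Ψ := by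
    intro w
    by_cases hw0 : w = 0
    · -- `T₂ δ_0 = 0`
      subst hw0
      have h0 : T₂ (Pi.single (0 : Fin 2 → K) 1) = 0 := by
        funext w'
        rw [hT₂, Pi.zero_apply]
        by_cases hw' : w' = 0
        · subst hw'
          simp only [Matrix.mulVec_zero, Pi.single_eq_same, mul_one, hsum]
        · refine Finset.sum_eq_zero fun t _ => ?_
          have hne : (φ t).val *ᵥ w' ≠ 0 := by
            intro h
            apply hw'
            have := congrArg (fun u => (φ t⁻¹).val *ᵥ u) h
            simp only [hcancel, Matrix.mulVec_zero] at this
            exact this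
          rw [Pi.single_eq_of_ne hne, mul_zero]
      rw [h0]
      exact zero_mem _
    rcases hdich w hw0 with ⟨v, hv, s₀, hs₀⟩ | ⟨b, hb⟩
    · -- orbit of a representative: `T₂ δ_w = ι_v (R δ_{s₀})`
      refine LinearMap.mem_range.2
        ⟨Pi.single ⟨v, hv⟩ ⟨R (Pi.single s₀ 1), LinearMap.mem_range_self R _⟩, ?_⟩
      funext w'
      rw [hΨ, hT₂, Fintype.sum_eq_single ⟨v, hv⟩ fun v' hv' => by
        rw [Pi.single_eq_of_ne hv']
        simp]
      rw [Pi.single_eq_same]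
      simp only [hR, Pi.single_apply]
      -- reindex `t = s₀ s⁻¹`
      refine Fintype.sum_equiv ((Equiv.inv _).trans (Equiv.mulLeft s₀)) _ _ fun s => ?_
      simp only [Equiv.trans_apply, Equiv.inv_apply, Equiv.coe_mulLeft]
      have hcond : ((φ (s₀ * s⁻¹)).val *ᵥ w' = w) ↔ ((φ s).val *ᵥ v = w') := by
        rw [← hs₀]
        constructor
        · intro h
          have h1 := hcancel (s₀ * s⁻¹) w'
          rw [h, ← hact, _root_.mul_inv_rev, inv_inv, inv_mul_cancel_right] at h1
          exact h1
        · intro h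
          rw [← h, ← hact, mul_assoc, inv_mul_cancel, mul_one]
      have hsum₀ : (∑ x : Matrix.SpecialLinearGroup (Fin 2) k,
          e x * if x * s = s₀ then (1 : ℂ) else 0) = e (s₀ * s⁻¹) := by
        have : ∀ x : Matrix.SpecialLinearGroup (Fin 2) k, (x * s = s₀) ↔ x = s₀ * s⁻¹ :=
          fun x => by rw [eq_mul_inv_iff_mul_eq]
        simp_rw [this]
        simp
      rw [hsum₀]
      by_cases hc : (φ s).val *ᵥ v = w'
      · rw [if_pos hc, if_pos (hcond.2 hc), one_mul, mul_one]
      · rw [if_neg hc, if_neg (fun h => hc (hcond.1 h)), zero_mul, mul_zero]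
    · -- stabiliser a conjugate root group: `T₂ δ_w = 0` by cuspidality on the coset
      have h0 : T₂ (Pi.single w 1) = 0 := by
        funext w'
        rw [hT₂, Pi.zero_apply]
        simp only [Pi.single_apply, mul_ite, mul_one, mul_zero]
        by_cases hex : ∃ t₀ : Matrix.SpecialLinearGroup (Fin 2) k, (φ t₀).val *ᵥ w' = w
        · obtain ⟨t₀, ht₀⟩ := hex
          have hiff : ∀ t : Matrix.SpecialLinearGroup (Fin 2) k, (φ t).val *ᵥ w' = w ↔
              ∃ x : k, t = b * ⟨!![(1 : k), x; 0, 1], sl2md_det_upper x⟩ * b⁻¹ * t₀ := by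
            intro t
            have h1 : (φ t).val *ᵥ w' = (φ (t * t₀⁻¹)).val *ᵥ w := by
              rw [← ht₀, ← hact, mul_assoc, inv_mul_cancel, mul_one]
            rw [h1, hb (t * t₀⁻¹)]
            constructor
            · rintro ⟨x, hx⟩
              exact ⟨x, mul_inv_eq_iff_eq_mul.1 hx⟩
            · rintro ⟨x, hx⟩
              exact ⟨x, mul_inv_eq_iff_eq_mul.2 hx⟩
          rw [← Finset.sum_filter]
          have hfilt : (Finset.univ.filter fun t : Matrix.SpecialLinearGroup (Fin 2) k =>
              (φ t).val *ᵥ w' = w) =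
              Finset.univ.image fun x : k =>
                b * ⟨!![(1 : k), x; 0, 1], sl2md_det_upper x⟩ * b⁻¹ * t₀ := by
            ext t
            simp only [Finset.mem_filter, Finset.mem_univ, true_and, Finset.mem_image, hiff]
            constructor
            · rintro ⟨x, hx⟩
              exact ⟨x, hx.symm⟩
            · rintro ⟨x, hx⟩
              exact ⟨x, hx.symm⟩
          rw [hfilt, Finset.sum_image]
          · have hc := hcusp t₀ (t₀⁻¹ * b)
            rw [← hc]
            refine Finset.sum_congr rfl fun x _ => ?_
            congr 1
            group
          · intro x _ y _ hxy
            have h3 := mul_left_cancel (mul_right_cancel (mul_right_cancel hxy))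
            have h4 := congrArg (fun g : Matrix.SpecialLinearGroup (Fin 2) k =>
              (g : Matrix (Fin 2) (Fin 2) k) 0 1) h3
            simpa using h4
        · push Not at hex
          exact Finset.sum_eq_zero fun t _ => if_neg (hex t)
      rw [h0]
      exact zero_mem _
  -- `range T₂ ≤ range Ψ`
  have hle : LinearMap.range T₂ ≤ LinearMap.range Ψ := by
    rw [LinearMap.range_eq_map, ← (Pi.basisFun ℂ (Fin 2 → K)).span_eq, Submodule.map_span,
      Submodule.span_le]
    rintro _ ⟨_, ⟨w, rfl⟩, rfl⟩
    rw [SetLike.mem_coe, Pi.basisFun_apply]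
    exact hδ w
  have hdom : finrank ℂ (↥Reps → ↥(LinearMap.range R)) =
      Reps.card * finrank ℂ (LinearMap.range R) := by
    rw [Module.finrank_pi_fintype ℂ, Finset.sum_const, Finset.card_univ, Fintype.card_coe,
      smul_eq_mul]
  calc finrank ℂ (LinearMap.range T₂)
      ≤ finrank ℂ (LinearMap.range Ψ) := Submodule.finrank_mono hle
    _ ≤ finrank ℂ (↥Reps → ↥(LinearMap.range R)) := LinearMap.finrank_range_le Ψ
    _ = Reps.card * finrank ℂ (LinearMap.range R) := hdom
    _ ≤ (Fintype.card k - 1) * finrank ℂ (LinearMap.range R) := Nat.mul_le_mul_right _ hReps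

end Summit.MatrixMultiplication.MatrixMultiplication.Theorems.GradedDesignFamily.Negative
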